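import Literature.NumberTheory.EllipticCurves.HeathBrown1994.CongruentTwoSelmerMonskyFamilies
import HarnessLib

set_option linter.dupNamespace false -- `Summit.BirchSwinnertonDyer.BirchSwinnertonDyer.Theorems.…` (summit = sub)
set_option autoImplicit false

/-!
# Crux `HeegnerTwistCouplingInSupply` (stmt-BirchSwinnertonDyer-21381) — the Rédei-ROBUST Monsky cells of card
# `three-squares-heegner-pin` (L2: `RobustCellARowTwo`, `RobustCellBRowTwo`, and the row-1 cell for `E_p`), PROVED

Route `BiquadraticEisensteinDescent` (cell `pub/bsd-wall`, row-12 line lead `bsd-line-ibd-p1` g10). Companion of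
`…ThreeSquaresPin.lean` (p642610) and `…ThreeSquaresPinDual.lean` (p643125). For three distinct odd primes
`(p, q, ℓ)` with `p ≡ 3 (mod 4)`, `q ≡ 3 (mod 8)`, `ℓ ≡ 5 (mod 8)`, Monsky's `6 × 6` matrix over `𝔽₂` (tree:
`HeathBrown1994.monskyMatrixEven` for `n = 2pqℓ`, `…monskyMatrixOdd` for `n = pqℓ`) has `det = 1` — i.e. `2`-Selmer
rank `s(n) = 0` by Monsky's theorem (the tree's named facts `monsky_card_selmerGroup_two_{odd,even}`) — in the following
cells, ROBUSTLY (for both values of the free symbol `(ℓ/q)` and, in the even case, both classes of `p (mod 8)`):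
* cell A (even, `n = 2pqℓ`): `(q/p) = +1`, `(ℓ/p) = −1` — the card's `RobustCellARowTwo` (corner `E_{2p}`, `p ≡ 11
  (mod 12)`, partner `q = 3`, `ℓ` the three-squares pin of p642610);
* cell B (even, `n = 2pqℓ`): `(q/p) = −1`, `(ℓ/p) = +1` — the card's `RobustCellBRowTwo` (corner `E_{2p}`,
  `p ≡ ±1 (mod 5)`, partner `ℓ = 5`, `q = ℓ′` the dual pin of p643125);
* row-1 cell (odd, `n = pqℓ`, `p ≡ 7 (mod 8)`): `(ℓ/p) = −1`, either value of `(q/p)` (corner `E_p`, `p ≡ 23 (mod 24)`).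
Method: the `3 × 3` blocks `A`, `D₂`, `D₋₁`, `D₋₂` of the tree's computable matrices are written out once for a
three-term vector (`legendreMatrix_three`, `legendreDiagonal_three`); in each cell the twelve additive symbols are
evaluated from the residues and reciprocity (as in the tree's two-prime families
`HeathBrown1994/CongruentTwoSelmerMonskyFamilies.lean`), and the resulting explicit matrix is certified invertible by an
exhibited inverse over `𝔽₂` checked by `decide` (`det M · det N = 1 ⇒ det M = 1`). THEOREMS ONLY; nothing about Selmer
groups, `L`-values or BSD is asserted here. Supports stmt-BirchSwinnertonDyer-21381 (typed sub-corner rung, not the crux).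
-/

namespace Summit.BirchSwinnertonDyer.BirchSwinnertonDyer.Theorems.BiquadraticEisensteinDescentHeegnerTwistCouplingInSupplyMonskyCells

open Matrix Literature.NumberTheory.EllipticCurves Literature.NumberTheory.EllipticCurves.HeathBrown1994
  Literature.NumberTheory.EllipticCurves.HeathBrown1994.Families

/-! ## §1 Tools -/

/-- Over `𝔽₂`, a matrix with a right inverse has determinant `1`. [folklore] -/
theorem det_eq_one_of_mul_eq_one {ι : Type*} [Fintype ι] [DecidableEq ι] (M N : Matrix ι ι (ZMod 2))
    (h : M * N = 1) : M.det = 1 := by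
  have h1 : M.det * N.det = 1 := by rw [← Matrix.det_mul, h, Matrix.det_one]
  have h2 : ∀ x : ZMod 2, x = 0 ∨ x = 1 := by decide
  rcases h2 M.det with h0 | h0
  · rw [h0, zero_mul] at h1
    exact absurd h1 (by decide)
  · exact h0

/-- Monsky's `A` for a three-term vector, written out: off-diagonal entries the additive symbols `[(p_j/p_i) ≠ 1]`, diagonal
entries the row sums. [cite: HeathBrown1994SelmerCongruentII, Appendix (Monsky), typescript p. 39 L13–L26] -/
theorem legendreMatrix_three (p q l : ℕ) :
    legendreMatrix ![p, q, l] =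
      !![addLegendreSym q p + addLegendreSym l p, addLegendreSym q p, addLegendreSym l p;
         addLegendreSym p q, addLegendreSym p q + addLegendreSym l q, addLegendreSym l q;
         addLegendreSym p l, addLegendreSym q l, addLegendreSym p l + addLegendreSym q l] := by
  ext i j
  fin_cases i <;> fin_cases j <;> simp [legendreMatrix, Fin.sum_univ_three] <;> ring

/-- Monsky's diagonal `D_a` for a three-term vector, written out. [cite: HeathBrown1994SelmerCongruentII, Appendix (Monsky), typescript p. 39 L10–L13] -/
theorem legendreDiagonal_three (p q l : ℕ) (a : ℤ) :
    legendreDiagonal ![p, q, l] a =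
      !![addLegendreSym a p, 0, 0; 0, addLegendreSym a q, 0; 0, 0, addLegendreSym a l] := by
  ext i j
  fin_cases i <;> fin_cases j <;> simp [legendreDiagonal, Matrix.diagonal]

/-! ## §2 The cells -/

section Cells

variable {p q l : ℕ}

/-- Symbol bookkeeping for `(p, q, ℓ)` with `p ≡ 3 (mod 4)`, `q ≡ 3 (mod 8)`, `ℓ ≡ 5 (mod 8)` (no primality needed):
reciprocity `(p/q) = −(q/p)`, `(p/ℓ) = (ℓ/p)`, `(q/ℓ) = (ℓ/q)`; supplements `(2/q) = (2/ℓ) = −1`,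
`(−1/p) = (−1/q) = −1` (tree: `DeuringLadic.jacobiSym_neg_one_of_mod_four`), `(−1/ℓ) = +1`, `(−2/q) = +1`,
`(−2/ℓ) = −1`. [folklore] -/
theorem symbols_of_triple (hp4 : p % 4 = 3) (hq8 : q % 8 = 3) (hl8 : l % 8 = 5) :
    jacobiSym (p : ℤ) q = -jacobiSym (q : ℤ) p ∧ jacobiSym (p : ℤ) l = jacobiSym (l : ℤ) p ∧
      jacobiSym (q : ℤ) l = jacobiSym (l : ℤ) q ∧ jacobiSym 2 q = -1 ∧ jacobiSym 2 l = -1 ∧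
      jacobiSym (-1) p = -1 ∧ jacobiSym (-1) q = -1 ∧ jacobiSym (-1) l = 1 ∧
      jacobiSym (-2) q = 1 ∧ jacobiSym (-2) l = -1 :=
  ⟨jacobiSym.quadratic_reciprocity_three_mod_four hp4 (by omega),
    jacobiSym.quadratic_reciprocity_one_mod_four' (Nat.odd_iff.mpr (by omega)) (by omega),
    jacobiSym.quadratic_reciprocity_one_mod_four' (Nat.odd_iff.mpr (by omega)) (by omega),
    jacobiSym_two_eq_neg_one (Or.inl hq8), jacobiSym_two_eq_neg_one (Or.inr hl8),
    DeuringLadic.jacobiSym_neg_one_of_mod_four hp4, DeuringLadic.jacobiSym_neg_one_of_mod_four (by omega),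
    jacobiSym_neg_one_eq_one (by omega),
    jacobiSym_neg_two_eq_one (Or.inr hq8), jacobiSym_neg_two_eq_neg_one (Or.inl hl8)⟩

/-- **Cell A, even matrix (card `three-squares-heegner-pin`, `RobustCellARowTwo`): `det M = 1`** for `n = 2pqℓ` with
`p ≡ 3 (mod 4)`, `q ≡ 3 (mod 8)`, `ℓ ≡ 5 (mod 8)` primes, `(q/p) = +1`, `(ℓ/p) = −1` — for both classes of `p (mod 8)`
and both values of the free symbol `(ℓ/q)`: four explicit `6 × 6` matrices over `𝔽₂`, each with an exhibited inverse.
[cite: HeathBrown1994SelmerCongruentII, Appendix (Monsky), typescript p. 41 L20–L36 (the matrix; evaluation ours)] -/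
theorem det_monskyMatrixEven_cellA (hq : q.Prime) (hl : l.Prime) (hp4 : p % 4 = 3)
    (hq8 : q % 8 = 3) (hl8 : l % 8 = 5) (hqp : jacobiSym (q : ℤ) p = 1) (hlp : jacobiSym (l : ℤ) p = -1) :
    (monskyMatrixEven ![p, q, l]).det = 1 := by
  obtain ⟨hpq, hpl, hql, h2q, h2l, hm1p, hm1q, hm1l, -, -⟩ := symbols_of_triple hp4 hq8 hl8
  rw [hqp] at hpq
  rw [hlp] at hpl
  have a_qp : addLegendreSym (q : ℤ) p = 0 := addLegendreSym_of_eq_one hqp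
  have a_pq : addLegendreSym (p : ℤ) q = 1 := addLegendreSym_of_eq_neg_one hpq
  have a_lp : addLegendreSym (l : ℤ) p = 1 := addLegendreSym_of_eq_neg_one hlp
  have a_pl : addLegendreSym (p : ℤ) l = 1 := addLegendreSym_of_eq_neg_one hpl
  have d2q : addLegendreSym 2 q = 1 := addLegendreSym_of_eq_neg_one h2q
  have d2l : addLegendreSym 2 l = 1 := addLegendreSym_of_eq_neg_one h2l
  have dm1p : addLegendreSym (-1) p = 1 := addLegendreSym_of_eq_neg_one hm1p
  have dm1q : addLegendreSym (-1) q = 1 := addLegendreSym_of_eq_neg_one hm1q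
  have dm1l : addLegendreSym (-1) l = 0 := addLegendreSym_of_eq_one hm1l
  have hlq_ne : l ≠ q := by
    rintro rfl
    omega
  have hp8' : p % 8 = 3 ∨ p % 8 = 7 := by omega
  rcases jacobiSym.eq_one_or_neg_one (int_gcd_eq_one_of_primes hl hq hlq_ne) with hlq | hlq <;>
    rw [hlq] at hql <;> rcases hp8' with hp8 | hp8
  · -- (ℓ/q) = 1, p ≡ 3 (mod 8)
    have a_lq : addLegendreSym (l : ℤ) q = 0 := addLegendreSym_of_eq_one hlq
    have a_ql : addLegendreSym (q : ℤ) l = 0 := addLegendreSym_of_eq_one hql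
    have d2p : addLegendreSym 2 p = 1 := addLegendreSym_of_eq_neg_one (jacobiSym_two_eq_neg_one (Or.inl hp8))
    rw [monskyMatrixEven, legendreMatrix_three, legendreDiagonal_three, legendreDiagonal_three,
      a_qp, a_pq, a_lp, a_pl, a_lq, a_ql, d2p, d2q, d2l, dm1p, dm1q, dm1l]
    exact det_eq_one_of_mul_eq_one _ (Matrix.fromBlocks !![0, 0, 1; 1, 0, 0; 1, 0, 0] !![0, 0, 0; 0, 0, 1; 0, 1, 0] !![1, 0, 0; 0, 1, 0; 0, 0, 1] !![0, 1, 1; 0, 0, 0; 1, 0, 0]) (by decide)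
  · -- (ℓ/q) = 1, p ≡ 7 (mod 8)
    have a_lq : addLegendreSym (l : ℤ) q = 0 := addLegendreSym_of_eq_one hlq
    have a_ql : addLegendreSym (q : ℤ) l = 0 := addLegendreSym_of_eq_one hql
    have d2p : addLegendreSym 2 p = 0 := addLegendreSym_of_eq_one (jacobiSym_two_eq_one (Or.inr hp8))
    rw [monskyMatrixEven, legendreMatrix_three, legendreDiagonal_three, legendreDiagonal_three,
      a_qp, a_pq, a_lp, a_pl, a_lq, a_ql, d2p, d2q, d2l, dm1p, dm1q, dm1l]
    exact det_eq_one_of_mul_eq_one _ (Matrix.fromBlocks !![0, 0, 1; 1, 0, 1; 1, 0, 1] !![0, 0, 0; 0, 0, 1; 0, 1, 0] !![1, 0, 1; 0, 1, 0; 1, 0, 1] !![0, 1, 1; 0, 0, 0; 1, 1, 1]) (by decide)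
  · -- (ℓ/q) = -1, p ≡ 3 (mod 8)
    have a_lq : addLegendreSym (l : ℤ) q = 1 := addLegendreSym_of_eq_neg_one hlq
    have a_ql : addLegendreSym (q : ℤ) l = 1 := addLegendreSym_of_eq_neg_one hql
    have d2p : addLegendreSym 2 p = 1 := addLegendreSym_of_eq_neg_one (jacobiSym_two_eq_neg_one (Or.inl hp8))
    rw [monskyMatrixEven, legendreMatrix_three, legendreDiagonal_three, legendreDiagonal_three,
      a_qp, a_pq, a_lp, a_pl, a_lq, a_ql, d2p, d2q, d2l, dm1p, dm1q, dm1l]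
    exact det_eq_one_of_mul_eq_one _ (Matrix.fromBlocks !![0, 0, 1; 1, 1, 1; 1, 1, 1] !![0, 1, 1; 1, 0, 1; 1, 1, 0] !![1, 0, 0; 0, 1, 0; 0, 0, 1] !![0, 1, 1; 0, 1, 1; 1, 1, 1]) (by decide)
  · -- (ℓ/q) = -1, p ≡ 7 (mod 8)
    have a_lq : addLegendreSym (l : ℤ) q = 1 := addLegendreSym_of_eq_neg_one hlq
    have a_ql : addLegendreSym (q : ℤ) l = 1 := addLegendreSym_of_eq_neg_one hql
    have d2p : addLegendreSym 2 p = 0 := addLegendreSym_of_eq_one (jacobiSym_two_eq_one (Or.inr hp8))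
    rw [monskyMatrixEven, legendreMatrix_three, legendreDiagonal_three, legendreDiagonal_three,
      a_qp, a_pq, a_lp, a_pl, a_lq, a_ql, d2p, d2q, d2l, dm1p, dm1q, dm1l]
    exact det_eq_one_of_mul_eq_one _ (Matrix.fromBlocks !![0, 0, 1; 0, 1, 0; 0, 1, 0] !![0, 1, 1; 1, 0, 1; 1, 1, 0] !![1, 0, 1; 0, 1, 0; 1, 0, 1] !![0, 0, 0; 0, 1, 1; 1, 0, 0]) (by decide)

/-- **Cell B, even matrix (card `three-squares-heegner-pin`, `RobustCellBRowTwo`): `det M = 1`** for `n = 2pqℓ` with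
`p ≡ 3 (mod 4)`, `q ≡ 3 (mod 8)`, `ℓ ≡ 5 (mod 8)` primes, `(q/p) = −1`, `(ℓ/p) = +1` — both classes of `p (mod 8)`, both
values of `(ℓ/q)`. [cite: HeathBrown1994SelmerCongruentII, Appendix (Monsky), typescript p. 41 L20–L36 (the matrix; evaluation ours)] -/
theorem det_monskyMatrixEven_cellB (hq : q.Prime) (hl : l.Prime) (hp4 : p % 4 = 3)
    (hq8 : q % 8 = 3) (hl8 : l % 8 = 5) (hqp : jacobiSym (q : ℤ) p = -1) (hlp : jacobiSym (l : ℤ) p = 1) :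
    (monskyMatrixEven ![p, q, l]).det = 1 := by
  obtain ⟨hpq, hpl, hql, h2q, h2l, hm1p, hm1q, hm1l, -, -⟩ := symbols_of_triple hp4 hq8 hl8
  rw [hqp] at hpq
  rw [hlp] at hpl
  rw [neg_neg] at hpq
  have a_qp : addLegendreSym (q : ℤ) p = 1 := addLegendreSym_of_eq_neg_one hqp
  have a_pq : addLegendreSym (p : ℤ) q = 0 := addLegendreSym_of_eq_one hpq
  have a_lp : addLegendreSym (l : ℤ) p = 0 := addLegendreSym_of_eq_one hlp
  have a_pl : addLegendreSym (p : ℤ) l = 0 := addLegendreSym_of_eq_one hpl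
  have d2q : addLegendreSym 2 q = 1 := addLegendreSym_of_eq_neg_one h2q
  have d2l : addLegendreSym 2 l = 1 := addLegendreSym_of_eq_neg_one h2l
  have dm1p : addLegendreSym (-1) p = 1 := addLegendreSym_of_eq_neg_one hm1p
  have dm1q : addLegendreSym (-1) q = 1 := addLegendreSym_of_eq_neg_one hm1q
  have dm1l : addLegendreSym (-1) l = 0 := addLegendreSym_of_eq_one hm1l
  have hlq_ne : l ≠ q := by
    rintro rfl
    omega
  have hp8' : p % 8 = 3 ∨ p % 8 = 7 := by omega
  rcases jacobiSym.eq_one_or_neg_one (int_gcd_eq_one_of_primes hl hq hlq_ne) with hlq | hlq <;>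
    rw [hlq] at hql <;> rcases hp8' with hp8 | hp8
  · -- (ℓ/q) = 1, p ≡ 3 (mod 8)
    have a_lq : addLegendreSym (l : ℤ) q = 0 := addLegendreSym_of_eq_one hlq
    have a_ql : addLegendreSym (q : ℤ) l = 0 := addLegendreSym_of_eq_one hql
    have d2p : addLegendreSym 2 p = 1 := addLegendreSym_of_eq_neg_one (jacobiSym_two_eq_neg_one (Or.inl hp8))
    rw [monskyMatrixEven, legendreMatrix_three, legendreDiagonal_three, legendreDiagonal_three,
      a_qp, a_pq, a_lp, a_pl, a_lq, a_ql, d2p, d2q, d2l, dm1p, dm1q, dm1l]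
    exact det_eq_one_of_mul_eq_one _ (Matrix.fromBlocks !![0, 1, 0; 0, 1, 0; 0, 0, 1] !![0, 1, 0; 1, 0, 0; 0, 0, 0] !![1, 0, 0; 0, 1, 0; 0, 0, 1] !![0, 0, 0; 1, 1, 0; 0, 0, 1]) (by decide)
  · -- (ℓ/q) = 1, p ≡ 7 (mod 8)
    have a_lq : addLegendreSym (l : ℤ) q = 0 := addLegendreSym_of_eq_one hlq
    have a_ql : addLegendreSym (q : ℤ) l = 0 := addLegendreSym_of_eq_one hql
    have d2p : addLegendreSym 2 p = 0 := addLegendreSym_of_eq_one (jacobiSym_two_eq_one (Or.inr hp8))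
    rw [monskyMatrixEven, legendreMatrix_three, legendreDiagonal_three, legendreDiagonal_three,
      a_qp, a_pq, a_lp, a_pl, a_lq, a_ql, d2p, d2q, d2l, dm1p, dm1q, dm1l]
    exact det_eq_one_of_mul_eq_one _ (Matrix.fromBlocks !![0, 1, 0; 1, 1, 0; 0, 0, 1] !![0, 1, 0; 1, 0, 0; 0, 0, 0] !![1, 1, 0; 1, 1, 0; 0, 0, 1] !![0, 1, 0; 1, 1, 0; 0, 0, 1]) (by decide)
  · -- (ℓ/q) = -1, p ≡ 3 (mod 8)
    have a_lq : addLegendreSym (l : ℤ) q = 1 := addLegendreSym_of_eq_neg_one hlq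
    have a_ql : addLegendreSym (q : ℤ) l = 1 := addLegendreSym_of_eq_neg_one hql
    have d2p : addLegendreSym 2 p = 1 := addLegendreSym_of_eq_neg_one (jacobiSym_two_eq_neg_one (Or.inl hp8))
    rw [monskyMatrixEven, legendreMatrix_three, legendreDiagonal_three, legendreDiagonal_three,
      a_qp, a_pq, a_lp, a_pl, a_lq, a_ql, d2p, d2q, d2l, dm1p, dm1q, dm1l]
    exact det_eq_one_of_mul_eq_one _ (Matrix.fromBlocks !![0, 1, 0; 0, 0, 1; 0, 1, 0] !![0, 0, 1; 0, 0, 0; 1, 0, 0] !![1, 0, 0; 0, 1, 0; 0, 0, 1] !![0, 0, 0; 1, 0, 1; 0, 1, 0]) (by decide)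
  · -- (ℓ/q) = -1, p ≡ 7 (mod 8)
    have a_lq : addLegendreSym (l : ℤ) q = 1 := addLegendreSym_of_eq_neg_one hlq
    have a_ql : addLegendreSym (q : ℤ) l = 1 := addLegendreSym_of_eq_neg_one hql
    have d2p : addLegendreSym 2 p = 0 := addLegendreSym_of_eq_one (jacobiSym_two_eq_one (Or.inr hp8))
    rw [monskyMatrixEven, legendreMatrix_three, legendreDiagonal_three, legendreDiagonal_three,
      a_qp, a_pq, a_lp, a_pl, a_lq, a_ql, d2p, d2q, d2l, dm1p, dm1q, dm1l]
    exact det_eq_one_of_mul_eq_one _ (Matrix.fromBlocks !![0, 1, 0; 0, 0, 1; 1, 1, 0] !![0, 0, 1; 0, 0, 0; 1, 0, 0] !![1, 1, 0; 1, 1, 0; 0, 0, 1] !![0, 0, 1; 1, 0, 1; 0, 1, 0]) (by decide)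

/-- **Row-1 cell, odd matrix (card `three-squares-heegner-pin`, corner `E_p`): `det M = 1`** for `n = pqℓ` with
`p ≡ 7 (mod 8)`, `q ≡ 3 (mod 8)`, `ℓ ≡ 5 (mod 8)` primes, `(ℓ/p) = −1` — for EITHER value of `(q/p)` and both values of
`(ℓ/q)`: four explicit `6 × 6` matrices over `𝔽₂` with exhibited inverses. (For `p ≡ 3 (mod 8)` the determinant is
NOT robust — it vanishes for one value of the free symbol — matching the card's restriction `p ≡ 23 (mod 24)`.)
[cite: HeathBrown1994SelmerCongruentII, Appendix (Monsky), typescript p. 39 L27–L33 (the matrix; evaluation ours)] -/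
theorem det_monskyMatrixOdd_cell_seven_mod_eight (hp : p.Prime) (hq : q.Prime) (hl : l.Prime)
    (hp8 : p % 8 = 7) (hq8 : q % 8 = 3) (hl8 : l % 8 = 5) (hlp : jacobiSym (l : ℤ) p = -1) :
    (monskyMatrixOdd ![p, q, l]).det = 1 := by
  obtain ⟨hpq, hpl, hql, h2q, h2l, -, -, -, hm2q, hm2l⟩ := symbols_of_triple (show p % 4 = 3 by omega) hq8 hl8
  rw [hlp] at hpl
  have a_lp : addLegendreSym (l : ℤ) p = 1 := addLegendreSym_of_eq_neg_one hlp
  have a_pl : addLegendreSym (p : ℤ) l = 1 := addLegendreSym_of_eq_neg_one hpl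
  have d2p : addLegendreSym 2 p = 0 := addLegendreSym_of_eq_one (jacobiSym_two_eq_one (Or.inr hp8))
  have d2q : addLegendreSym 2 q = 1 := addLegendreSym_of_eq_neg_one h2q
  have d2l : addLegendreSym 2 l = 1 := addLegendreSym_of_eq_neg_one h2l
  have dm2p : addLegendreSym (-2) p = 1 := addLegendreSym_of_eq_neg_one (jacobiSym_neg_two_eq_neg_one (Or.inr hp8))
  have dm2q : addLegendreSym (-2) q = 0 := addLegendreSym_of_eq_one hm2q
  have dm2l : addLegendreSym (-2) l = 1 := addLegendreSym_of_eq_neg_one hm2l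
  have hlq_ne : l ≠ q := by
    rintro rfl
    omega
  have hqp_ne : q ≠ p := by
    rintro rfl
    omega
  rcases jacobiSym.eq_one_or_neg_one (int_gcd_eq_one_of_primes hq hp hqp_ne) with hqp | hqp <;>
    rw [hqp] at hpq <;>
    rcases jacobiSym.eq_one_or_neg_one (int_gcd_eq_one_of_primes hl hq hlq_ne) with hlq | hlq <;> rw [hlq] at hql
  · -- (q/p) = 1, (ℓ/q) = 1
    have a_qp : addLegendreSym (q : ℤ) p = 0 := addLegendreSym_of_eq_one hqp
    have a_pq : addLegendreSym (p : ℤ) q = 1 := addLegendreSym_of_eq_neg_one hpq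
    have a_lq : addLegendreSym (l : ℤ) q = 0 := addLegendreSym_of_eq_one hlq
    have a_ql : addLegendreSym (q : ℤ) l = 0 := addLegendreSym_of_eq_one hql
    rw [monskyMatrixOdd, legendreMatrix_three, legendreDiagonal_three, legendreDiagonal_three,
      a_qp, a_pq, a_lp, a_pl, a_lq, a_ql, d2p, d2q, d2l, dm2p, dm2q, dm2l]
    exact det_eq_one_of_mul_eq_one _ (Matrix.fromBlocks !![0, 0, 1; 1, 1, 0; 1, 0, 1] !![1, 0, 0; 0, 1, 1; 1, 0, 0] !![1, 0, 1; 0, 1, 1; 0, 0, 0] !![1, 0, 1; 1, 0, 0; 1, 0, 0]) (by decide)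
  · -- (q/p) = 1, (ℓ/q) = -1
    have a_qp : addLegendreSym (q : ℤ) p = 0 := addLegendreSym_of_eq_one hqp
    have a_pq : addLegendreSym (p : ℤ) q = 1 := addLegendreSym_of_eq_neg_one hpq
    have a_lq : addLegendreSym (l : ℤ) q = 1 := addLegendreSym_of_eq_neg_one hlq
    have a_ql : addLegendreSym (q : ℤ) l = 1 := addLegendreSym_of_eq_neg_one hql
    rw [monskyMatrixOdd, legendreMatrix_three, legendreDiagonal_three, legendreDiagonal_three,
      a_qp, a_pq, a_lp, a_pl, a_lq, a_ql, d2p, d2q, d2l, dm2p, dm2q, dm2l]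
    exact det_eq_one_of_mul_eq_one _ (Matrix.fromBlocks !![0, 1, 0; 1, 0, 1; 1, 1, 0] !![0, 1, 1; 1, 0, 0; 0, 1, 1] !![1, 0, 1; 0, 1, 1; 0, 0, 0] !![0, 1, 0; 1, 0, 0; 1, 0, 0]) (by decide)
  · -- (q/p) = -1, (ℓ/q) = 1
    rw [neg_neg] at hpq
    have a_qp : addLegendreSym (q : ℤ) p = 1 := addLegendreSym_of_eq_neg_one hqp
    have a_pq : addLegendreSym (p : ℤ) q = 0 := addLegendreSym_of_eq_one hpq
    have a_lq : addLegendreSym (l : ℤ) q = 0 := addLegendreSym_of_eq_one hlq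
    have a_ql : addLegendreSym (q : ℤ) l = 0 := addLegendreSym_of_eq_one hql
    rw [monskyMatrixOdd, legendreMatrix_three, legendreDiagonal_three, legendreDiagonal_three,
      a_qp, a_pq, a_lp, a_pl, a_lq, a_ql, d2p, d2q, d2l, dm2p, dm2q, dm2l]
    exact det_eq_one_of_mul_eq_one _ (Matrix.fromBlocks !![1, 1, 1; 0, 0, 0; 1, 0, 0] !![1, 0, 1; 0, 1, 0; 0, 1, 0] !![1, 0, 0; 0, 1, 0; 1, 1, 0] !![0, 1, 1; 0, 1, 0; 1, 0, 1]) (by decide)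
  · -- (q/p) = -1, (ℓ/q) = -1
    rw [neg_neg] at hpq
    have a_qp : addLegendreSym (q : ℤ) p = 1 := addLegendreSym_of_eq_neg_one hqp
    have a_pq : addLegendreSym (p : ℤ) q = 0 := addLegendreSym_of_eq_one hpq
    have a_lq : addLegendreSym (l : ℤ) q = 1 := addLegendreSym_of_eq_neg_one hlq
    have a_ql : addLegendreSym (q : ℤ) l = 1 := addLegendreSym_of_eq_neg_one hql
    rw [monskyMatrixOdd, legendreMatrix_three, legendreDiagonal_three, legendreDiagonal_three,
      a_qp, a_pq, a_lp, a_pl, a_lq, a_ql, d2p, d2q, d2l, dm2p, dm2q, dm2l]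
    exact det_eq_one_of_mul_eq_one _ (Matrix.fromBlocks !![0, 1, 1; 1, 0, 0; 0, 0, 0] !![0, 1, 0; 1, 0, 1; 1, 0, 1] !![1, 0, 0; 0, 1, 0; 1, 1, 0] !![0, 1, 1; 1, 0, 1; 0, 1, 0]) (by decide)

end Cells

/-! ## §3 The card's statements, verbatim -/

/-- **`RobustCellARowTwo`** (card `three-squares-heegner-pin`, signature VERBATIM from `SketchIdeasSeat2G14.lean`), PROVED.
[cite: HeathBrown1994SelmerCongruentII, Appendix (Monsky), typescript p. 41 L20–L36 (the matrix; evaluation ours)] -/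
theorem robustCellARowTwo :
    ∀ (q : Fin 3 → ℕ), (∀ i, (q i).Prime) → q 0 % 4 = 3 → q 1 % 8 = 3 → q 2 % 8 = 5 →
      jacobiSym (q 1 : ℤ) (q 0) = 1 → jacobiSym (q 2 : ℤ) (q 0) = -1 →
      (HeathBrown1994.monskyMatrixEven q).det = 1 := by
  intro q hq h0 h1 h2 hs1 hs2
  have hq' : q = ![q 0, q 1, q 2] := by
    funext i
    fin_cases i <;> rfl
  rw [hq']
  exact det_monskyMatrixEven_cellA (hq 1) (hq 2) h0 h1 h2 hs1 hs2

/-- **`RobustCellBRowTwo`** (card `three-squares-heegner-pin`, signature VERBATIM from `SketchIdeasSeat2G14.lean`), PROVED.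
[cite: HeathBrown1994SelmerCongruentII, Appendix (Monsky), typescript p. 41 L20–L36 (the matrix; evaluation ours)] -/
theorem robustCellBRowTwo :
    ∀ (q : Fin 3 → ℕ), (∀ i, (q i).Prime) → q 0 % 4 = 3 → q 1 % 8 = 3 → q 2 % 8 = 5 →
      jacobiSym (q 1 : ℤ) (q 0) = -1 → jacobiSym (q 2 : ℤ) (q 0) = 1 →
      (HeathBrown1994.monskyMatrixEven q).det = 1 := by
  intro q hq h0 h1 h2 hs1 hs2
  have hq' : q = ![q 0, q 1, q 2] := by
    funext i
    fin_cases i <;> rfl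
  rw [hq']
  exact det_monskyMatrixEven_cellB (hq 1) (hq 2) h0 h1 h2 hs1 hs2

end Summit.BirchSwinnertonDyer.BirchSwinnertonDyer.Theorems.BiquadraticEisensteinDescentHeegnerTwistCouplingInSupplyMonskyCells
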